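import Summits.CriticalPhenomena.CardyFormulaZ2.Theses.CardyRotToConf
import Mathlib.MeasureTheory.Measure.Lebesgue.Complex
import Mathlib.Topology.Connected.LocallyConnected
import HarnessLib

/-!
# Fat germs of planar open sets: the firing predicate of the fat-germ one-shot surgery
# (crux `CardyRotToConfR2SymmetryUpgrade`, stmt-CriticalPhenomena-0698, line germ-label-transport)

The one-shot surgery of an admissible chordal family (negative lane of the crux) FIRES on a
Dobrushin domain `(U; a, b)` according to a predicate of the GERM of `U` at `a` which is invariant
under similarities. This file defines that predicate and proves its germ locality:

* `branchSet U a r = (frontier U ∩ ball a r) \ {a}` — the boundary near `a`, punctured at `a`;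
* `FatBothSides U a` — for arbitrarily small `r`, the punctured boundary `branchSet U a r` has two
  distinct connected components accumulating at `a`, and EVERY component accumulating at `a` is
  not Lebesgue-null (is contained in no set of planar Lebesgue measure zero);
* `HalfDiscAt U a n` — `U` contains the open half-disc `{w ∈ B(a, r) | ⟨w - a, n⟩ > 0}` for some
  `r > 0` (`⟨x, n⟩ = re (x * conj n)`);
* `Fires U a` — `FatBothSides U a` and there is EXACTLY ONE unit vector `n` with `HalfDiscAt U a n`;
  `fireDir U a` — that unit vector (the direction of the surgery chord), `0` if `U` does not fire.

Main statements: `Fires.norm_fireDir`, `Fires.halfDiscAt_fireDir`, `Fires.eq_fireDir`, and the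
germ locality `frontier_inter_ball_congr`, `branchSet_congr`, `FatBothSides.congr`,
`HalfDiscAt.congr`, `Fires.congr`, `fireDir_congr` (sets agreeing in a ball about `a` fire alike,
with the same direction). Negative lane: no Theses statement is asserted.
-/

noncomputable section

open Set Filter Topology Metric MeasureTheory
open scoped ComplexConjugate

namespace Summit.CriticalPhenomena.CardyFormulaZ2.Theorems.CardyRotToConfR2SymmetryUpgrade.Negative

/-! ### The punctured boundary near a point and the fat-germ predicate -/

/-- The boundary of `U` inside the ball `B(a, r)`, punctured at `a`. [folklore] -/
def branchSet (U : Set ℂ) (a : ℂ) (r : ℝ) : Set ℂ := (frontier U ∩ ball a r) \ {a}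

/-- Unfolding `branchSet`. [folklore] -/
theorem mem_branchSet {U : Set ℂ} {a : ℂ} {r : ℝ} {x : ℂ} :
    x ∈ branchSet U a r ↔ x ∈ frontier U ∧ dist x a < r ∧ x ≠ a := by
  simp [branchSet, mem_ball, and_assoc]

/-- `branchSet U a r ⊆ frontier U`. [folklore] -/
theorem branchSet_subset_frontier (U : Set ℂ) (a : ℂ) (r : ℝ) : branchSet U a r ⊆ frontier U :=
  fun _ h => h.1.1

/-- `branchSet U a r ⊆ ball a r`. [folklore] -/
theorem branchSet_subset_ball (U : Set ℂ) (a : ℂ) (r : ℝ) : branchSet U a r ⊆ ball a r :=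
  fun _ h => h.1.2

/-- `branchSet` is monotone in the radius. [folklore] -/
theorem branchSet_mono (U : Set ℂ) (a : ℂ) {r r' : ℝ} (h : r ≤ r') : branchSet U a r ⊆ branchSet U a r' :=
  fun _ hx => ⟨⟨hx.1.1, ball_subset_ball h hx.1.2⟩, hx.2⟩

/-- **Fat on both sides.** The germ of `U` at `a` is FAT ON BOTH SIDES if for arbitrarily small
radii `r` the punctured boundary `branchSet U a r` has two distinct connected components
accumulating at `a`, and every connected component accumulating at `a` is contained in no planar
Lebesgue-null set. For a Jordan domain the components accumulating at `a` are the two boundary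
branches at `a` up to their first exits from the ball, so this says: both branches have positive
(outer) area in every neighbourhood of `a` (an Osgood-type boundary point). [folklore] -/
def FatBothSides (U : Set ℂ) (a : ℂ) : Prop :=
  ∀ ε > (0 : ℝ), ∃ r ∈ Ioo (0 : ℝ) ε,
    (∃ x ∈ branchSet U a r, ∃ y ∈ branchSet U a r,
      connectedComponentIn (branchSet U a r) x ≠ connectedComponentIn (branchSet U a r) y ∧
      a ∈ closure (connectedComponentIn (branchSet U a r) x) ∧
      a ∈ closure (connectedComponentIn (branchSet U a r) y)) ∧
    (∀ x ∈ branchSet U a r, a ∈ closure (connectedComponentIn (branchSet U a r) x) →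
      ∀ N : Set ℂ, volume N = 0 → ¬ connectedComponentIn (branchSet U a r) x ⊆ N)

/-- The real inner product `⟨x, n⟩ = re (x * conj n)` of `ℂ ≅ ℝ²`. [folklore] -/
def rIP (x n : ℂ) : ℝ := (x * conj n).re

/-- `rIP x n = x.re * n.re + x.im * n.im`. [folklore] -/
theorem rIP_eq (x n : ℂ) : rIP x n = x.re * n.re + x.im * n.im := by
  simp [rIP, Complex.mul_re]

/-- `rIP` is additive in the first variable. [folklore] -/
theorem rIP_add_left (x y n : ℂ) : rIP (x + y) n = rIP x n + rIP y n := by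
  simp [rIP, add_mul]

/-- `rIP` is real-homogeneous in the first variable. [folklore] -/
theorem rIP_smul_left (t : ℝ) (x n : ℂ) : rIP ((t : ℂ) * x) n = t * rIP x n := by
  simp [rIP, mul_assoc]

/-- `rIP n n = ‖n‖²`. [folklore] -/
theorem rIP_self (n : ℂ) : rIP n n = ‖n‖ ^ 2 := by
  rw [rIP, Complex.mul_conj, ← Complex.sq_norm]
  norm_cast

/-- **Half-disc germ.** `U` contains, near `a`, the open half-disc in direction `n`:
`{w | dist w a < r, ⟨w - a, n⟩ > 0} ⊆ U` for some `r > 0`. [folklore] -/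
def HalfDiscAt (U : Set ℂ) (a n : ℂ) : Prop :=
  ∃ r > (0 : ℝ), ∀ w : ℂ, dist w a < r → 0 < rIP (w - a) n → w ∈ U

/-- **The firing predicate** of the fat-germ surgery: the germ of `U` at `a` is fat on both sides
and `U` contains near `a` exactly one open half-disc (with unit normal `n`). [folklore] -/
def Fires (U : Set ℂ) (a : ℂ) : Prop :=
  FatBothSides U a ∧ ∃! n : ℂ, ‖n‖ = 1 ∧ HalfDiscAt U a n

/-- **The firing direction**: the unique unit inward half-disc normal of a firing germ (`0` if the
germ does not fire). [folklore] -/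
def fireDir (U : Set ℂ) (a : ℂ) : ℂ :=
  open scoped Classical in
  if h : Fires U a then Classical.choose h.2.exists else 0

namespace Fires

variable {U : Set ℂ} {a : ℂ}

/-- A firing germ is fat on both sides. [folklore] -/
theorem fatBothSides (h : Fires U a) : FatBothSides U a := h.1

/-- The firing direction of a firing germ is the chosen witness. [folklore] -/
theorem fireDir_eq (h : Fires U a) : fireDir U a = Classical.choose h.2.exists := by
  rw [fireDir, dif_pos h]

/-- The firing direction is a unit vector. [folklore] -/
theorem norm_fireDir (h : Fires U a) : ‖fireDir U a‖ = 1 := by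
  rw [h.fireDir_eq]; exact (Classical.choose_spec h.2.exists).1

/-- The firing direction is nonzero. [folklore] -/
theorem fireDir_ne_zero (h : Fires U a) : fireDir U a ≠ 0 := by
  rw [← norm_pos_iff, h.norm_fireDir]; exact one_pos

/-- `U` contains the open half-disc in the firing direction near `a`. [folklore] -/
theorem halfDiscAt_fireDir (h : Fires U a) : HalfDiscAt U a (fireDir U a) := by
  rw [h.fireDir_eq]; exact (Classical.choose_spec h.2.exists).2

/-- **Uniqueness of the direction**: any unit half-disc normal is the firing direction. [folklore] -/
theorem eq_fireDir (h : Fires U a) {n : ℂ} (hn : ‖n‖ = 1) (hU : HalfDiscAt U a n) :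
    n = fireDir U a :=
  h.2.unique ⟨hn, hU⟩ ⟨h.norm_fireDir, h.halfDiscAt_fireDir⟩

/-- Points `a + t • fireDir`, `0 < t` small, lie in `U`. [folklore] -/
theorem exists_add_mul_fireDir_mem (h : Fires U a) :
    ∃ r > (0 : ℝ), ∀ t : ℝ, 0 < t → t < r → a + (t : ℂ) * fireDir U a ∈ U := by
  obtain ⟨r, hr, hU⟩ := h.halfDiscAt_fireDir
  refine ⟨r, hr, fun t ht0 htr => hU _ ?_ ?_⟩
  · rw [dist_eq_norm, add_sub_cancel_left, norm_mul, Complex.norm_real, h.norm_fireDir, mul_one,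
      Real.norm_eq_abs, abs_of_pos ht0]
    exact htr
  · rw [add_sub_cancel_left, rIP_smul_left, rIP_self, h.norm_fireDir]
    simpa using ht0

end Fires

/-- If `U` does not fire at `a`, the firing direction is `0`. [folklore] -/
theorem fireDir_of_not_fires {U : Set ℂ} {a : ℂ} (h : ¬ Fires U a) : fireDir U a = 0 := by
  rw [fireDir, dif_neg h]

/-! ### Germ locality: everything depends on `U ∩ ball a ρ` only -/

section Locality

variable {U U' : Set ℂ} {a : ℂ} {ρ : ℝ}

/-- Closure is local: inside an open ball, `closure U` only depends on `U ∩ ball`. [folklore] -/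
theorem closure_inter_ball_congr (h : U ∩ ball a ρ = U' ∩ ball a ρ) :
    closure U ∩ ball a ρ = closure U' ∩ ball a ρ := by
  have key : ∀ {V V' : Set ℂ}, V ∩ ball a ρ = V' ∩ ball a ρ → closure V ∩ ball a ρ ⊆ closure V' := by
    intro V V' hVV' x ⟨hx, hxb⟩
    rw [mem_closure_iff_nhds] at hx ⊢
    intro t ht
    have := hx (t ∩ ball a ρ) (inter_mem ht (isOpen_ball.mem_nhds hxb))
    obtain ⟨y, ⟨hyt, hyb⟩, hyV⟩ := this
    have hy' : y ∈ V' ∩ ball a ρ := by rw [← hVV']; exact ⟨hyV, hyb⟩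
    exact ⟨y, hyt, hy'.1⟩
  exact Subset.antisymm (fun x hx => ⟨key h hx, hx.2⟩) (fun x hx => ⟨key h.symm hx, hx.2⟩)

/-- Interior is local: inside an open ball, `interior U` only depends on `U ∩ ball`. [folklore] -/
theorem interior_inter_ball_congr (h : U ∩ ball a ρ = U' ∩ ball a ρ) :
    interior U ∩ ball a ρ = interior U' ∩ ball a ρ := by
  have e : interior U ∩ ball a ρ = interior (U ∩ ball a ρ) := by
    rw [interior_inter, isOpen_ball.interior_eq]
  have e' : interior U' ∩ ball a ρ = interior (U' ∩ ball a ρ) := by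
    rw [interior_inter, isOpen_ball.interior_eq]
  rw [e, e', h]

/-- **Frontier is local**: sets agreeing in `ball a ρ` have the same frontier there. [folklore] -/
theorem frontier_inter_ball_congr (h : U ∩ ball a ρ = U' ∩ ball a ρ) :
    frontier U ∩ ball a ρ = frontier U' ∩ ball a ρ := by
  rw [frontier_eq_closure_inter_closure, frontier_eq_closure_inter_closure]
  have hc : Uᶜ ∩ ball a ρ = U'ᶜ ∩ ball a ρ := by
    ext x
    constructor
    · rintro ⟨hxU, hxb⟩
      refine ⟨fun hxU' => hxU ?_, hxb⟩
      have : x ∈ U' ∩ ball a ρ := ⟨hxU', hxb⟩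
      rw [← h] at this
      exact this.1
    · rintro ⟨hxU', hxb⟩
      refine ⟨fun hxU => hxU' ?_, hxb⟩
      have : x ∈ U ∩ ball a ρ := ⟨hxU, hxb⟩
      rw [h] at this
      exact this.1
  have h1 := closure_inter_ball_congr h
  have h2 := closure_inter_ball_congr hc
  ext x
  constructor
  · rintro ⟨⟨hx1, hx2⟩, hxb⟩
    have e1 : x ∈ closure U' ∩ ball a ρ := by rw [← h1]; exact ⟨hx1, hxb⟩
    have e2 : x ∈ closure U'ᶜ ∩ ball a ρ := by rw [← h2]; exact ⟨hx2, hxb⟩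
    exact ⟨⟨e1.1, e2.1⟩, hxb⟩
  · rintro ⟨⟨hx1, hx2⟩, hxb⟩
    have e1 : x ∈ closure U ∩ ball a ρ := by rw [h1]; exact ⟨hx1, hxb⟩
    have e2 : x ∈ closure Uᶜ ∩ ball a ρ := by rw [h2]; exact ⟨hx2, hxb⟩
    exact ⟨⟨e1.1, e2.1⟩, hxb⟩

/-- Sets agreeing in `ball a ρ` have the same punctured boundary at every radius `r ≤ ρ`.
[folklore] -/
theorem branchSet_congr (h : U ∩ ball a ρ = U' ∩ ball a ρ) {r : ℝ} (hr : r ≤ ρ) :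
    branchSet U a r = branchSet U' a r := by
  have key : frontier U ∩ ball a r = frontier U' ∩ ball a r := by
    have := frontier_inter_ball_congr h
    ext x
    constructor
    · rintro ⟨hx, hxr⟩
      have : x ∈ frontier U' ∩ ball a ρ := by rw [← this]; exact ⟨hx, ball_subset_ball hr hxr⟩
      exact ⟨this.1, hxr⟩
    · rintro ⟨hx, hxr⟩
      have : x ∈ frontier U ∩ ball a ρ := by rw [this]; exact ⟨hx, ball_subset_ball hr hxr⟩
      exact ⟨this.1, hxr⟩
  rw [branchSet, branchSet, key]

/-- **`FatBothSides` is a germ property.** [folklore] -/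
theorem FatBothSides.congr (hU : FatBothSides U a) (hρ : 0 < ρ) (h : U ∩ ball a ρ = U' ∩ ball a ρ) :
    FatBothSides U' a := by
  intro ε hε
  obtain ⟨r, ⟨hr0, hrε⟩, hfat⟩ := hU (min ε ρ) (lt_min hε hρ)
  have hrρ : r ≤ ρ := (hrε.trans_le (min_le_right _ _)).le
  refine ⟨r, ⟨hr0, hrε.trans_le (min_le_left _ _)⟩, ?_⟩
  rwa [← branchSet_congr h hrρ]

/-- **`HalfDiscAt` is a germ property.** [folklore] -/
theorem HalfDiscAt.congr {n : ℂ} (hU : HalfDiscAt U a n) (hρ : 0 < ρ)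
    (h : U ∩ ball a ρ = U' ∩ ball a ρ) : HalfDiscAt U' a n := by
  obtain ⟨r, hr, hn⟩ := hU
  refine ⟨min r ρ, lt_min hr hρ, fun w hw hip => ?_⟩
  have hwU : w ∈ U := hn w (hw.trans_le (min_le_left _ _)) hip
  have : w ∈ U ∩ ball a ρ := ⟨hwU, mem_ball.2 (hw.trans_le (min_le_right _ _))⟩
  rw [h] at this
  exact this.1

/-- `HalfDiscAt` for sets agreeing in a ball: an equivalence. [folklore] -/
theorem halfDiscAt_congr {n : ℂ} (hρ : 0 < ρ) (h : U ∩ ball a ρ = U' ∩ ball a ρ) :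
    HalfDiscAt U a n ↔ HalfDiscAt U' a n :=
  ⟨fun hU => hU.congr hρ h, fun hU' => hU'.congr hρ h.symm⟩

/-- **`Fires` is a germ property.** [folklore] -/
theorem Fires.congr (hU : Fires U a) (hρ : 0 < ρ) (h : U ∩ ball a ρ = U' ∩ ball a ρ) : Fires U' a := by
  refine ⟨hU.1.congr hρ h, ?_⟩
  obtain ⟨n, hn, huniq⟩ := hU.2
  refine ⟨n, ⟨hn.1, hn.2.congr hρ h⟩, fun m hm => huniq m ⟨hm.1, hm.2.congr hρ h.symm⟩⟩

/-- `Fires` for sets agreeing in a ball: an equivalence. [folklore] -/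
theorem fires_congr (hρ : 0 < ρ) (h : U ∩ ball a ρ = U' ∩ ball a ρ) : Fires U a ↔ Fires U' a :=
  ⟨fun hU => hU.congr hρ h, fun hU' => hU'.congr hρ h.symm⟩

/-- **The firing direction is a germ invariant.** [folklore] -/
theorem fireDir_congr (hρ : 0 < ρ) (h : U ∩ ball a ρ = U' ∩ ball a ρ) : fireDir U a = fireDir U' a := by
  by_cases hU : Fires U a
  · have hU' : Fires U' a := hU.congr hρ h
    exact hU'.eq_fireDir hU.norm_fireDir (hU.halfDiscAt_fireDir.congr hρ h)
  · have hU' : ¬ Fires U' a := fun h' => hU (h'.congr hρ h.symm)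
    rw [fireDir_of_not_fires hU, fireDir_of_not_fires hU']

end Locality

/-! ### Sets that do not fire -/

/-- **No fat components, no fire.** If for all small radii every component of the punctured
boundary accumulating at `a` is contained in a Lebesgue-null set — e.g. when the whole boundary
near `a` is null — then `U` is not fat on both sides at `a`. [folklore] -/
theorem not_fatBothSides_of_null {U : Set ℂ} {a : ℂ} {ρ : ℝ} (hρ : 0 < ρ) {N : Set ℂ}
    (hN : volume N = 0) (hsub : frontier U ∩ ball a ρ ⊆ N ∪ {a}) : ¬ FatBothSides U a := by
  intro h
  obtain ⟨r, ⟨-, hrρ⟩, ⟨x, hx, -, -, -, hax, -⟩, hnull⟩ := h ρ hρ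
  refine hnull x hx hax N hN ?_
  intro y hy
  have hy' := connectedComponentIn_subset _ _ hy
  rcases hsub ⟨hy'.1.1, ball_subset_ball hrρ.le hy'.1.2⟩ with hyN | hya
  · exact hyN
  · exact absurd hya hy'.2

/-- A set whose boundary near `a` is Lebesgue-null does not fire at `a`. [folklore] -/
theorem not_fires_of_null {U : Set ℂ} {a : ℂ} {ρ : ℝ} (hρ : 0 < ρ) {N : Set ℂ}
    (hN : volume N = 0) (hsub : frontier U ∩ ball a ρ ⊆ N ∪ {a}) : ¬ Fires U a :=
  fun h => not_fatBothSides_of_null hρ hN hsub h.1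

/-- **A null component accumulating at `a` prevents firing**: if some radius-`r` punctured
boundary (all small `r`) has a connected component accumulating at `a` and contained in a null
set, `U` is not fat on both sides. Used for crosscut domains at the landing point (the chord side
is a segment). [folklore] -/
theorem not_fatBothSides_of_null_component {U : Set ℂ} {a : ℂ} {ρ : ℝ} (hρ : 0 < ρ)
    (h : ∀ r ∈ Ioo (0 : ℝ) ρ, ∃ x ∈ branchSet U a r, ∃ N : Set ℂ, volume N = 0 ∧
      a ∈ closure (connectedComponentIn (branchSet U a r) x) ∧
      connectedComponentIn (branchSet U a r) x ⊆ N) : ¬ FatBothSides U a := by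
  intro hfat
  obtain ⟨r, hr, -, hnull⟩ := hfat ρ hρ
  obtain ⟨x, hx, N, hN, hax, hsub⟩ := h r hr
  exact hnull x hx hax N hN hsub

end Summit.CriticalPhenomena.CardyFormulaZ2.Theorems.CardyRotToConfR2SymmetryUpgrade.Negative

end
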